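import Literature.NumberTheory.Automorphic.ArchStableConjugacyLocalGlobal    -- ★ (V8)-glob FILE 1: `isStablyConj_arch_iff_forall_place`, `isConj_arch_iff_forall_place`, `conjClasses_mk_eq_mk_iff_forall_place`
import Literature.NumberTheory.Automorphic.ArchLocalRegularTorusClasses      -- ★ (V8)-reg part II (p838737): per-place criterion ∕ exhaustion ∕ list ∕ count at `archLocal L N (diagonal α) w`
import Literature.NumberTheory.Rogawski1990.ArchimedeanTransfer              -- ★ `archStableOrbitalIntegral` (LETTER #4), ★ `stableOrbitalIntegralRel_eq_sum`
import HarnessLib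

/-!
# The REGULAR archimedean stable class of a torus point of `G′_∞ = U(diag α)(L⁺ ⊗ ℝ)`: listed, counted (`Π_w C(N, p_w)`), and `Φ^st_∞` at it as a `Finset.sum`
# (Rogawski 1990 §4.1 (4.1.1) p. 39, §3.7 Prop. 3.7.1 pp. 29–30, §8.2 Prop. 8.2.1 p. 118, §14.2 p. 232)

Topic `NumberTheory/Automorphic`; namespace `Literature.NumberTheory.Automorphic.UnitaryGroup`.  THEOREMS ONLY (no definition, no instance, no notation, no named fact, no `sorry`).
Cell `pub/hodgecm-mathlib`, ENGINE T1 (crux H413 = `stmt-HodgeConjecture-24833`); floor-1 preparation, count-neutral, under books rows #88 (ST-∞) ∕ #111 (S-d): road D2′, brick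
**«(V8)-glob» FILE 2** (LEAD WORD T7-29, F0P3a-plan (g8), 2026-09-01; author F0P3a-p02 (g9)) — the GLOBAL form of ★ (V8)-reg (`UnitaryDiagonalFormTorusClasses`,
`ArchLocalRegularTorusClasses`, p838576 ∕ p838737) through ★ FILE 1 `ArchStableConjugacyLocalGlobal` (stable conjugacy and conjugacy in `G′_∞` are checked place by place).

CARRIERS (token-exact, LEAD guardrail (i)): the stable class is the index set of ★ `archStableOrbitalIntegral L N H m a γ` (`Rogawski1990/ArchimedeanTransfer.lean` :209–220,
an `abbrev` for ★ `stableOrbitalIntegralRel (IsStablyConj (conjMixed L⁺ L c) (archFormOf L N H)) m a γ = ∑ᶠ q ∈ {q ∣ IsStablyConj … γ (Quotient.out q)}, classOrbitalIntegral m a q`,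
`Rogawski1990/LocalTransfer.lean` :106) as READ by ★ `IsArchInnerTransfer` (14.2.1), the (S-d) letter ★ `ArchCentralValueTransferExists` :251–253 and ★ `ArchStableOrbitalIntegralCentral`;
torus points are ★ D1′b `archDiagTorus L N α z`, `z : (complex places) → Fin N → S¹`, REGULAR iff every `z_w` is injective (★ `isRegularElt_archDiagTorus_iff`); `α` diagonal hermitian
(`c α_i = α_i`) non-degenerate (`α_i ≠ 0`).

WHAT IS PROVED.
* `archStableOrbitalIntegral_eq_finset_sum_of_finite` (general `H`, any `γ`, ANY `a`): `Φ^st_∞(γ, a) = ∑_{q ∈ hfin.toFinset} Φ(q, a)` once the stable class of `γ` meets finitely many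
  classes (★ `stableOrbitalIntegralRel_eq_sum`; no compact support, unlike ★ `archStableOrbitalIntegral_eq_sum`).
* `archPiEquivCM_archDiagTorus` (`t(z)_w = diag(z_w)` in `archLocal`), **`isStablyConj_archDiagTorus_iff_exists`** (`t(z) ∼_st t(z′)` iff `z′_w = z_w ∘ ρ_w` for all `w`),
  **`isConj_archDiagTorus_iff_exists`** (`t(z) ∼ t(z′)` iff moreover every `ρ_w` preserves the signs of `re σ_w(α_i)`), **`exists_isConj_archDiagTorus_of_isStablyConj`**
  (EXHAUSTION: the regular stable class is covered by the `Π_w S_N`-orbit in the torus).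
* **`conjClasses_stable_archDiagTorus_eq_range`** ∕ `finite_conjClasses_stable_archDiagTorus`: `{q ∣ t(z) ∼_st q.out} = range (ρ ↦ ⟦t(w ↦ z_w ∘ ρ_w)⟧)`, finite;
  `mk_archDiagTorus_eq_mk_iff` (two such classes agree iff `ρ_w(P_w) = ρ′_w(P_w)` at every `w`, `P_w = {i ∣ re σ_w(α_i) > 0}`);
  **`ncard_conjClasses_stable_archDiagTorus = Π_w Nat.choose N #P_w`** (Mathlib `Fintype.piFinset_image` ∕ `card_piFinset` + ★ part I book-keeping) — `= 3` for `N = 3`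
  and `α` of signature `(2,1)` at one place, definite elsewhere (§14.2).
* **`archStableOrbitalIntegral_archDiagTorus_eq_sum`**: `Φ^st_∞(t(z), a) = ∑_{q ∈ univ.image (ρ ↦ ⟦t(z ∘ ρ)⟧)} Φ(q, a)` for EVERY family `m` and EVERY `a` — print's
  `Φ^st(γ, f) = Σ_{γ′} Φ(γ′, f)` over `{γ, γ₁, γ₂}` (§8.2), the finite-sum form the limit formulas (ST-∞)∕(L-st) differentiate at floor 2.
CONSUMERS AT FLOOR 2 (LEAD T7-30, for the desk's D2′ typing, by name): (L-use) ∕ (L-st) «`D_G·Φ^st` differentiated at `ψ = 0+`» ← `archStableOrbitalIntegral_archDiagTorus_eq_sum` (g4);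
(ST-∞) «three regular classes degenerate to the two singular ones» ← `conjClasses_stable_archDiagTorus_eq_range` ∕ `ncard_conjClasses_stable_archDiagTorus` (g3); the (S-d) CENTRAL point
is already ★ `archStableOrbitalIntegral_signed_eq_of_central` (F0P3a-p06, `ArchStableOrbitalIntegralCentral`); the exhaustion `exists_isConj_archDiagTorus_of_isStablyConj` serves
★ `IsArchInnerTransfer` (14.2.1) at regular classes (every `γ′ ↔ γ` is conjugate to a torus point).
JUNK AUDIT: `hz` (regular) is necessary for the list∕count∕sum (a singular torus point has fewer, block-indexed classes — «(V8)-sing», B-p17 (g23)); `hα`, `hherm` as in part II; FILE 1's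
iff's are hypothesis-free.  HONEST LABEL: HC_CM is proved only modulo the printed citations until rung 0 closes; this file is group-theoretic book-keeping and pays nothing by itself.

## References
* [Rogawski1990] J. D. Rogawski, *Automorphic Representations of Unitary Groups in Three Variables*, Ann. of Math. Stud. 123 (1990): §3.1 p. 19, §3.7 Prop. 3.7.1 pp. 29–30
  (`Ω_F(T,G) = S₃`; over `ℝ`, `Ω(T,G) = ℤ∕2`), §4.1 (4.1.1) p. 39 (`Φ^st = Σ_{γ′}`), §4.9 p. 54, §8.2 Prop. 8.2.1 p. 118 (`γ, γ₁, γ₂`; chunk p0119 «if `E∕F = ℂ∕ℝ`, then `γ‴` does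
  not occur»), §14.2 p. 232 (archimedean places of the inner form) — held e-text chunks p0032–p0033, p0043, p0117–p0119 read.
* [BorelJacquet1979] A. Borel, H. Jacquet, *Automorphic forms and automorphic representations*, PSPM 33.1 (1979), §4.1 (`G_∞ = Π_{v∣∞} G(F_v)`).
* [BrockerTomDieck1985] Th. Bröcker, T. tom Dieck, *Representations of Compact Lie Groups*, GTM 98 (1985), Ch. IV (3.1)–(3.2).
-/

set_option autoImplicit false

noncomputable section

open Matrix Equiv NumberField NumberField.InfinitePlace NumberField.mixedEmbedding
open scoped MatrixGroups ComplexConjugate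

namespace Literature.NumberTheory.Automorphic

namespace UnitaryGroup

open Literature.LinearAlgebra.Matrix Literature.NumberTheory.Rogawski1990

section General

variable (L : Type) [Field L] [NumberField L] [IsCMField L] (N : ℕ) (H : Matrix (Fin N) (Fin N) L)

variable [∀ g : ↥(arch (↥(maximalRealSubfield L)) L (IsCMField.complexConj L) N H),
    MeasurableSpace (↥(arch (↥(maximalRealSubfield L)) L (IsCMField.complexConj L) N H) ⧸
      Subgroup.centralizer ({g} : Set ↥(arch (↥(maximalRealSubfield L)) L (IsCMField.complexConj L) N H)))]

/-- **`Φ^st_∞(γ, a)` IS A FINITE SUM whenever the stable class of `γ` meets finitely many classes** — `archStableOrbitalIntegral m a γ = ∑_{q} Φ(q, a)` over the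
`Finset` of classes `q` with `γ ∼_st q.out` (★ `stableOrbitalIntegralRel_eq_sum` on the `arch` carrier; ANY `a`, no compact support — compare ★ `archStableOrbitalIntegral_eq_sum`,
which needs `a ∈ C_c`). [cite: Rogawski1990, §4.1 (4.1.1) p. 39] -/
theorem archStableOrbitalIntegral_eq_finset_sum_of_finite
    (m : OrbitalMeasureFamily ↥(arch (↥(maximalRealSubfield L)) L (IsCMField.complexConj L) N H))
    (a : ↥(arch (↥(maximalRealSubfield L)) L (IsCMField.complexConj L) N H) → ℂ)
    (γ : arch (↥(maximalRealSubfield L)) L (IsCMField.complexConj L) N H)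
    (hfin : {q : ConjClasses ↥(arch (↥(maximalRealSubfield L)) L (IsCMField.complexConj L) N H) |
      IsStablyConj (conjMixed (↥(maximalRealSubfield L)) L (IsCMField.complexConj L)) (archFormOf L N H) γ (Quotient.out q)}.Finite) :
    archStableOrbitalIntegral L N H m a γ = ∑ q ∈ hfin.toFinset, classOrbitalIntegral m a q :=
  stableOrbitalIntegralRel_eq_sum m a hfin

end General

section Torus

variable (L : Type) [Field L] [NumberField L] [IsCMField L] (N : ℕ) (α : Fin N → L)

/-- **The `w`-component of the torus point `t(z)` is the circle-torus point `diag(z_w)` of `G_w`** (★ `archAt_archDiagTorus`, as an equality in `archLocal L N (diagonal α) w`).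
[cite: Rogawski1990, §4.9 p. 54] [cite: BorelJacquet1979, §4.1] -/
theorem archPiEquivCM_archDiagTorus (z : {w : InfinitePlace L // IsComplex w} → Fin N → Circle) (w : {w : InfinitePlace L // IsComplex w}) :
    archPiEquivCM N L (diagonal α) (archDiagTorus L N α z) w =
      ⟨circleDiagonal N (z w), circleDiagonal_mem_archLocal_diagonal L N α w (z w)⟩ :=
  Subtype.ext (archAt_archDiagTorus L N α z w)

/-- Hermitian diagonal entries are real at every complex place (★ `im_embedding_eq_zero_of_complexConj_eq`). [cite: Rogawski1990, §4.9 p. 54] -/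
theorem im_embedding_diagonal_eq_zero (hherm : ∀ i, (IsCMField.complexConj L (α i) : L) = α i) (w : {w : InfinitePlace L // IsComplex w}) (i : Fin N) :
    (w.1.embedding (α i)).im = 0 :=
  im_embedding_eq_zero_of_complexConj_eq L w (hherm i)

/-- **STABLE CONJUGACY OF REGULAR TORUS POINTS OF `G′_∞` = A PERMUTATION OF THE COORDINATES AT EVERY PLACE**: for `z` injective at every `w` (★ `isRegularElt_archDiagTorus_iff`),
`t(z) ∼_st t(z′)` iff `z′_w = z_w ∘ ρ_w` for some family of permutations `ρ = (ρ_w)`. [cite: Rogawski1990, §3.1 p. 19; §3.7 Prop. 3.7.1 pp. 29–30] [cite: BorelJacquet1979, §4.1] -/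
theorem isStablyConj_archDiagTorus_iff_exists {z : {w : InfinitePlace L // IsComplex w} → Fin N → Circle} (hz : ∀ w, Function.Injective (z w))
    (z' : {w : InfinitePlace L // IsComplex w} → Fin N → Circle) :
    IsStablyConj (conjMixed (↥(maximalRealSubfield L)) L (IsCMField.complexConj L)) (archFormOf L N (diagonal α))
        (archDiagTorus L N α z) (archDiagTorus L N α z') ↔
      ∃ ρ : {w : InfinitePlace L // IsComplex w} → Perm (Fin N), z' = fun w => z w ∘ ρ w := by
  rw [isStablyConj_arch_iff_forall_place]
  simp only [archPiEquivCM_archDiagTorus]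
  constructor
  · intro h
    choose ρ hρ using fun w => (isStablyConj_circleDiagonal_iff_exists_perm L N α w (hz w)).mp (h w)
    exact ⟨ρ, funext hρ⟩
  · rintro ⟨ρ, rfl⟩ w
    exact (isStablyConj_circleDiagonal_iff_exists_perm L N α w (hz w)).mpr ⟨ρ w, rfl⟩

/-- **CONJUGACY OF REGULAR TORUS POINTS OF `G′_∞` ↔ A SIGN-COMPATIBLE PERMUTATION AT EVERY PLACE**: `t(z) ∼ t(z′)` in `U(diag α)(L⁺ ⊗ ℝ)` iff `z′_w = z_w ∘ ρ_w` with each `ρ_w`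
preserving the signs of `re σ_w(α_i)` (`α` hermitian non-degenerate; ★ part II `isConj_circleDiagonal_iff_exists_perm` place by place). [cite: Rogawski1990, §3.7 Prop. 3.7.1 pp. 29–30; §8.2 Prop. 8.2.1 p. 118]
[cite: BrockerTomDieck1985, Ch. IV (3.2)] -/
theorem isConj_archDiagTorus_iff_exists (hα : ∀ i, α i ≠ 0) (hherm : ∀ i, (IsCMField.complexConj L (α i) : L) = α i)
    {z : {w : InfinitePlace L // IsComplex w} → Fin N → Circle} (hz : ∀ w, Function.Injective (z w))
    (z' : {w : InfinitePlace L // IsComplex w} → Fin N → Circle) :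
    IsConj (archDiagTorus L N α z) (archDiagTorus L N α z') ↔
      ∃ ρ : {w : InfinitePlace L // IsComplex w} → Perm (Fin N), (z' = fun w => z w ∘ ρ w) ∧
        ∀ (w : {w : InfinitePlace L // IsComplex w}) (i : Fin N), 0 < (w.1.embedding (α (ρ w i))).re ↔ 0 < (w.1.embedding (α i)).re := by
  rw [isConj_arch_iff_forall_place]
  simp only [archPiEquivCM_archDiagTorus]
  constructor
  · intro h
    choose ρ hρ hsign using fun w =>
      (isConj_circleDiagonal_iff_exists_perm L N α w hα (im_embedding_diagonal_eq_zero L N α hherm w) (hz w)).mp (h w)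
    exact ⟨ρ, funext hρ, hsign⟩
  · rintro ⟨ρ, rfl, hsign⟩ w
    exact (isConj_circleDiagonal_iff_exists_perm L N α w hα (im_embedding_diagonal_eq_zero L N α hherm w) (hz w)).mpr ⟨ρ w, rfl, hsign w⟩

/-- **EXHAUSTION IN `G′_∞`**: every `δ ∈ U(diag α)(L⁺ ⊗ ℝ)` stably conjugate to a regular torus point `t(z)` is conjugate IN `G′_∞` to a torus point `t(w ↦ z_w ∘ ρ_w)` — the
regular stable class is covered by the `Π_w S_N`-orbit of `t(z)` in the torus. [cite: Rogawski1990, §3.7 Prop. 3.7.1 pp. 29–30; §8.2 Prop. 8.2.1 p. 118] [cite: BorelJacquet1979, §4.1] -/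
theorem exists_isConj_archDiagTorus_of_isStablyConj (hα : ∀ i, α i ≠ 0) (hherm : ∀ i, (IsCMField.complexConj L (α i) : L) = α i)
    {z : {w : InfinitePlace L // IsComplex w} → Fin N → Circle} (hz : ∀ w, Function.Injective (z w))
    (δ : arch (↥(maximalRealSubfield L)) L (IsCMField.complexConj L) N (diagonal α))
    (h : IsStablyConj (conjMixed (↥(maximalRealSubfield L)) L (IsCMField.complexConj L)) (archFormOf L N (diagonal α)) (archDiagTorus L N α z) δ) :
    ∃ ρ : {w : InfinitePlace L // IsComplex w} → Perm (Fin N), IsConj (archDiagTorus L N α fun w => z w ∘ ρ w) δ := by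
  rw [isStablyConj_arch_iff_forall_place] at h
  simp only [archPiEquivCM_archDiagTorus] at h
  choose ρ hρ using fun w => exists_perm_isConj_circleDiagonal_of_isStablyConj L N α w hα (im_embedding_diagonal_eq_zero L N α hherm w)
    (hz w) _ (h w)
  refine ⟨ρ, (isConj_arch_iff_forall_place L N (diagonal α) _ _).mpr fun w => ?_⟩
  rw [archPiEquivCM_archDiagTorus]
  exact hρ w

/-- **THE REGULAR ARCHIMEDEAN STABLE CLASS OF A TORUS POINT, LISTED** — exactly the classes of the torus points `t(w ↦ z_w ∘ ρ_w)`, `ρ ∈ Π_w S_N`: the index set of the `∑ᶠ`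
inside ★ `archStableOrbitalIntegral L N (diagonal α) m a (t z)` (`Rogawski1990/ArchimedeanTransfer.lean`, `stableOrbitalIntegralRel`). [cite: Rogawski1990, §4.1 (4.1.1) p. 39; §3.7 Prop. 3.7.1 pp. 29–30]
[cite: BorelJacquet1979, §4.1] -/
theorem conjClasses_stable_archDiagTorus_eq_range (hα : ∀ i, α i ≠ 0) (hherm : ∀ i, (IsCMField.complexConj L (α i) : L) = α i)
    {z : {w : InfinitePlace L // IsComplex w} → Fin N → Circle} (hz : ∀ w, Function.Injective (z w)) :
    {q : ConjClasses ↥(arch (↥(maximalRealSubfield L)) L (IsCMField.complexConj L) N (diagonal α)) |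
        IsStablyConj (conjMixed (↥(maximalRealSubfield L)) L (IsCMField.complexConj L)) (archFormOf L N (diagonal α))
          (archDiagTorus L N α z) (Quotient.out q)} =
      Set.range fun ρ : {w : InfinitePlace L // IsComplex w} → Perm (Fin N) => ConjClasses.mk (archDiagTorus L N α fun w => z w ∘ ρ w) := by
  ext q
  rw [Set.mem_setOf_eq, Set.mem_range]
  constructor
  · intro hq
    obtain ⟨ρ, hρ⟩ := exists_isConj_archDiagTorus_of_isStablyConj L N α hα hherm hz _ hq
    exact ⟨ρ, (ConjClasses.mk_eq_mk_iff_isConj.mpr hρ).trans (Quotient.out_eq q)⟩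
  · rintro ⟨ρ, rfl⟩
    have h1 : IsConj (archDiagTorus L N α fun w => z w ∘ ρ w)
        (Quotient.out (ConjClasses.mk (archDiagTorus L N α fun w => z w ∘ ρ w)) : _) :=
      ConjClasses.mk_eq_mk_iff_isConj.mp (Quotient.out_eq (ConjClasses.mk (archDiagTorus L N α fun w => z w ∘ ρ w))).symm
    exact ((isStablyConj_archDiagTorus_iff_exists L N α hz _).mpr ⟨ρ, rfl⟩).trans (isStablyConj_of_isConj h1)

/-- The regular archimedean stable class of a torus point meets FINITELY many classes. [cite: Rogawski1990, §4.1 (4.1.1) p. 39] -/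
theorem finite_conjClasses_stable_archDiagTorus (hα : ∀ i, α i ≠ 0) (hherm : ∀ i, (IsCMField.complexConj L (α i) : L) = α i)
    {z : {w : InfinitePlace L // IsComplex w} → Fin N → Circle} (hz : ∀ w, Function.Injective (z w)) :
    {q : ConjClasses ↥(arch (↥(maximalRealSubfield L)) L (IsCMField.complexConj L) N (diagonal α)) |
        IsStablyConj (conjMixed (↥(maximalRealSubfield L)) L (IsCMField.complexConj L)) (archFormOf L N (diagonal α))
          (archDiagTorus L N α z) (Quotient.out q)}.Finite := by
  rw [conjClasses_stable_archDiagTorus_eq_range L N α hα hherm hz]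
  exact Set.finite_range _

/-- Two torus points `t(z ∘ ρ)`, `t(z ∘ ρ′)` of one regular stable class are conjugate in `G′_∞` iff `ρ_w(P_w) = ρ′_w(P_w)` at every place, `P_w = {i ∣ re σ_w(α_i) > 0}` (the class
remembers, place by place, which eigenvalues sit on positive lines). [cite: Rogawski1990, §3.7 Prop. 3.7.1 pp. 29–30; §8.2 Prop. 8.2.1 p. 118] -/
theorem mk_archDiagTorus_eq_mk_iff (hα : ∀ i, α i ≠ 0) (hherm : ∀ i, (IsCMField.complexConj L (α i) : L) = α i)
    {z : {w : InfinitePlace L // IsComplex w} → Fin N → Circle} (hz : ∀ w, Function.Injective (z w))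
    (ρ ρ' : {w : InfinitePlace L // IsComplex w} → Perm (Fin N)) :
    ConjClasses.mk (archDiagTorus L N α fun w => z w ∘ ρ w) = ConjClasses.mk (archDiagTorus L N α fun w => z w ∘ ρ' w) ↔
      ∀ w : {w : InfinitePlace L // IsComplex w},
        (Finset.univ.filter fun i => 0 < (w.1.embedding (α i)).re).image (ρ w) = (Finset.univ.filter fun i => 0 < (w.1.embedding (α i)).re).image (ρ' w) := by
  rw [conjClasses_mk_eq_mk_iff_forall_place]
  refine forall_congr' fun w => ?_
  rw [archPiEquivCM_archDiagTorus, archPiEquivCM_archDiagTorus]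
  exact mk_circleDiagonal_eq_mk_iff_image_eq_image N (archLocal L N (diagonal α) w) (fun i => (w.1.embedding (α i)).re)
    (mem_archLocal_diagonal_iff_mem_unitaryGroupOfForm L N α w (im_embedding_diagonal_eq_zero L N α hherm w))
    (re_embedding_ne_zero L N α w hα (im_embedding_diagonal_eq_zero L N α hherm w)) (hz w) (ρ w) (ρ' w)

open scoped Classical in
/-- **THE GLOBAL COUNT `#{classes in the regular archimedean stable class} = Π_w C(N, p_w)`**, `p_w = #{i ∣ re σ_w(α_i) > 0}` — for `N = 3` and `α` of signature `(2,1)` at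
exactly one place and definite elsewhere (the Picard ∕ Kottwitz situation of §14.2) this is `3`. [cite: Rogawski1990, §3.7 Prop. 3.7.1 pp. 29–30; §8.2 Prop. 8.2.1 p. 118; §14.2 p. 232]
[cite: BrockerTomDieck1985, Ch. IV (3.2)] -/
theorem ncard_conjClasses_stable_archDiagTorus (hα : ∀ i, α i ≠ 0) (hherm : ∀ i, (IsCMField.complexConj L (α i) : L) = α i)
    {z : {w : InfinitePlace L // IsComplex w} → Fin N → Circle} (hz : ∀ w, Function.Injective (z w)) :
    {q : ConjClasses ↥(arch (↥(maximalRealSubfield L)) L (IsCMField.complexConj L) N (diagonal α)) |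
        IsStablyConj (conjMixed (↥(maximalRealSubfield L)) L (IsCMField.complexConj L)) (archFormOf L N (diagonal α))
          (archDiagTorus L N α z) (Quotient.out q)}.ncard =
      ∏ w : {w : InfinitePlace L // IsComplex w}, Nat.choose N (Finset.univ.filter fun i => 0 < (w.1.embedding (α i)).re).card := by
  classical
  set F : ({w : InfinitePlace L // IsComplex w} → Perm (Fin N)) → ConjClasses ↥(arch (↥(maximalRealSubfield L)) L (IsCMField.complexConj L) N (diagonal α)) :=
    fun ρ => ConjClasses.mk (archDiagTorus L N α fun w => z w ∘ ρ w) with hF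
  set G : ({w : InfinitePlace L // IsComplex w} → Perm (Fin N)) → ({w : InfinitePlace L // IsComplex w} → Finset (Fin N)) :=
    fun ρ w => (Finset.univ.filter fun i => 0 < (w.1.embedding (α i)).re).image (ρ w) with hG
  have hrange : Set.range F = ↑(Finset.univ.image F) := by rw [Finset.coe_image, Finset.coe_univ, Set.image_univ]
  have hFG : ∀ a ∈ (Finset.univ : Finset ({w : InfinitePlace L // IsComplex w} → Perm (Fin N))), ∀ b ∈ Finset.univ, F a = F b ↔ G a = G b :=
    fun a _ b _ => (mk_archDiagTorus_eq_mk_iff L N α hα hherm hz a b).trans funext_iff.symm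
  have hGimg : Finset.univ.image G =
      Fintype.piFinset fun w : {w : InfinitePlace L // IsComplex w} =>
        (Finset.univ : Finset (Perm (Fin N))).image fun σ : Perm (Fin N) =>
          (Finset.univ.filter fun i => 0 < (w.1.embedding (α i)).re).image ⇑σ := by
    rw [Fintype.piFinset_image, Fintype.piFinset_univ]
  rw [conjClasses_stable_archDiagTorus_eq_range L N α hα hherm hz, ← hF, hrange, Set.ncard_coe_finset,
    card_image_eq_card_image_of_iff Finset.univ F G hFG, hGimg, Fintype.card_piFinset]
  refine Finset.prod_congr rfl fun w _ => ?_
  rw [image_univ_image_perm_eq_powersetCard, Finset.card_powersetCard, Finset.card_univ, Fintype.card_fin]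

variable [∀ g : ↥(arch (↥(maximalRealSubfield L)) L (IsCMField.complexConj L) N (diagonal α)),
    MeasurableSpace (↥(arch (↥(maximalRealSubfield L)) L (IsCMField.complexConj L) N (diagonal α)) ⧸
      Subgroup.centralizer ({g} : Set ↥(arch (↥(maximalRealSubfield L)) L (IsCMField.complexConj L) N (diagonal α))))]

open scoped Classical in
/-- **`Φ^st_∞(t(z), a)` AS A `Finset.sum`** — at a regular torus point of `G′_∞ = U(diag α)(L⁺ ⊗ ℝ)` the archimedean stable orbital integral of LETTER #4 (★
`archStableOrbitalIntegral`, any family `m`, ANY function `a`) is the finite sum of the class orbital integrals `Φ(⟦t(w ↦ z_w ∘ ρ_w)⟧, a)` over the DISTINCT classes of the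
permuted torus points, `ρ ∈ Π_w S_N` — print's `Φ^st(γ, f) = Σ_{γ′} Φ(γ′, f)`, `{γ′} = {γ, γ₁, γ₂}` at a place of signature `(2,1)`.  The form that the limit formulas (ST-∞)∕(L-st)
differentiate along the one-angle curves. [cite: Rogawski1990, §4.1 (4.1.1) p. 39; §8.2 Prop. 8.2.1 p. 118; §14.2 p. 232] -/
theorem archStableOrbitalIntegral_archDiagTorus_eq_sum (hα : ∀ i, α i ≠ 0) (hherm : ∀ i, (IsCMField.complexConj L (α i) : L) = α i)
    {z : {w : InfinitePlace L // IsComplex w} → Fin N → Circle} (hz : ∀ w, Function.Injective (z w))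
    (m : OrbitalMeasureFamily ↥(arch (↥(maximalRealSubfield L)) L (IsCMField.complexConj L) N (diagonal α)))
    (a : ↥(arch (↥(maximalRealSubfield L)) L (IsCMField.complexConj L) N (diagonal α)) → ℂ) :
    archStableOrbitalIntegral L N (diagonal α) m a (archDiagTorus L N α z) =
      ∑ q ∈ Finset.univ.image (fun ρ : {w : InfinitePlace L // IsComplex w} → Perm (Fin N) => ConjClasses.mk (archDiagTorus L N α fun w => z w ∘ ρ w)),
        classOrbitalIntegral m a q := by
  rw [archStableOrbitalIntegral_eq_finset_sum_of_finite L N (diagonal α) m a _ (finite_conjClasses_stable_archDiagTorus L N α hα hherm hz)]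
  refine Finset.sum_congr ?_ fun _ _ => rfl
  apply Finset.coe_injective
  rw [Set.Finite.coe_toFinset, conjClasses_stable_archDiagTorus_eq_range L N α hα hherm hz, Finset.coe_image, Finset.coe_univ, Set.image_univ]

end Torus

end UnitaryGroup

end Literature.NumberTheory.Automorphic

end
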